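import Mathlib

/-!
# Termwise higher derivatives of a series of holomorphic functions (via Cauchy's formula)

Topic `Literature/Analysis/Complex`, namespace `Literature.Analysis.Complex`. Everything here is PROVED
(theorems only).

Mathlib has termwise FIRST derivatives of uniformly summable series of holomorphic functions
(`Complex.hasSum_deriv_of_summable_norm`).  For the higher-derivative explicit formulae of `L`-functions
(Hadamard expansion of `ξ'/ξ` differentiated `k` times; polygamma series) one needs all orders at once:

* `hasSum_iteratedDeriv_of_summable_norm` — if every `f_i` and `g` are holomorphic on the closed disc
  `|z − c| ≤ R`, `‖f_i‖ ≤ u_i` on the circle `|z − c| = R` with `∑ u_i < ∞`, and `∑_i f_i(z) = g(z)` on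
  that circle, then for every `k`: `∑_i f_i^{(k)}(c) = g^{(k)}(c)` (as a `HasSum`);
* `iteratedDeriv_inv_sub_const`, `iteratedDeriv_inv_add_const` — `(d/dz)^k (z ∓ a)⁻¹ = (−1)^k k! (z ∓ a)^{−k−1}`.

Proof: Cauchy's formula for derivatives on the circle
(`DifferentiableOn.circleIntegral_one_div_sub_center_pow_smul`) for `g` and for each `f_i`, and Lebesgue's
dominated convergence for series (`intervalIntegral.hasSum_integral_of_dominated_convergence`) to
interchange `∑_i` with the circle integral, the integrands being dominated by `R^{−k} u_i`. [folklore]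

## References

* L. V. Ahlfors, *Complex Analysis*, 3rd ed., Ch. 5 §1.1 (Weierstrass's theorem on termwise
  differentiation). [folklore]
-/

noncomputable section

open Complex Metric Set MeasureTheory Filter Topology
open scoped Real Interval

namespace Literature.Analysis.Complex

/-- **Termwise `k`-th derivatives of a series of holomorphic functions.**  Let `R > 0`, `∑ u_i < ∞`,
every `f_i` holomorphic on `closedBall c R` with `‖f_i z‖ ≤ u_i` on `sphere c R`, `g` holomorphic on
`closedBall c R` with `∑_i f_i z = g z` on `sphere c R`.  Then `∑_i (f_i)^{(k)}(c) = g^{(k)}(c)`.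
[folklore] -/
theorem hasSum_iteratedDeriv_of_summable_norm {ι : Type*} [Countable ι] {f : ι → ℂ → ℂ} {g : ℂ → ℂ}
    {c : ℂ} {R : ℝ} (hR : 0 < R) {u : ι → ℝ} (hu : Summable u)
    (hf : ∀ i, DifferentiableOn ℂ (f i) (closedBall c R))
    (hle : ∀ i, ∀ z ∈ sphere c R, ‖f i z‖ ≤ u i)
    (hg : DifferentiableOn ℂ g (closedBall c R))
    (hsum : ∀ z ∈ sphere c R, HasSum (fun i ↦ f i z) (g z)) (k : ℕ) :
    HasSum (fun i ↦ iteratedDeriv k (f i) c) (iteratedDeriv k g c) := by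
  -- Cauchy's formula for `g` and each `f i`
  have hCg := hg.circleIntegral_one_div_sub_center_pow_smul hR k
  have hCf := fun i ↦ (hf i).circleIntegral_one_div_sub_center_pow_smul hR k
  -- the parametrised integrands
  set w : ℝ → ℂ := circleMap c R with hw
  set F : ι → ℝ → ℂ := fun i θ ↦ deriv (circleMap c R) θ • ((1 / (w θ - c) ^ (k + 1)) • f i (w θ)) with hF
  set G : ℝ → ℂ := fun θ ↦ deriv (circleMap c R) θ • ((1 / (w θ - c) ^ (k + 1)) • g (w θ)) with hG
  have hw_mem : ∀ θ, w θ ∈ sphere c R := fun θ ↦ circleMap_mem_sphere c hR.le θ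
  have hw_sub : ∀ θ, ‖w θ - c‖ = R := by
    intro θ
    have := hw_mem θ
    rwa [mem_sphere, dist_eq_norm] at this
  have hw_ne : ∀ θ, w θ - c ≠ 0 := fun θ h ↦ by
    have := hw_sub θ; rw [h, norm_zero] at this; linarith
  have hderiv_norm : ∀ θ, ‖deriv (circleMap c R) θ‖ = R := by
    intro θ
    rw [deriv_circleMap, norm_mul, Complex.norm_I, mul_one, norm_circleMap_zero, abs_of_pos hR]
  -- continuity of the integrands
  have hw_cont : Continuous w := continuous_circleMap c R
  have hcont_comp : ∀ {h : ℂ → ℂ}, DifferentiableOn ℂ h (closedBall c R) → Continuous fun θ ↦ h (w θ) := by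
    intro h hh
    exact hh.continuousOn.comp_continuous hw_cont fun θ ↦ sphere_subset_closedBall (hw_mem θ)
  have hinv_cont : Continuous fun θ ↦ (1 : ℂ) / (w θ - c) ^ (k + 1) :=
    Continuous.div continuous_const ((hw_cont.sub continuous_const).pow _)
      fun θ ↦ pow_ne_zero _ (hw_ne θ)
  have hder_cont : Continuous fun θ ↦ deriv (circleMap c R) θ := by
    simp_rw [deriv_circleMap]; exact (continuous_circleMap 0 R).mul continuous_const
  have hF_cont : ∀ i, Continuous (F i) := fun i ↦
    hder_cont.smul (hinv_cont.smul (hcont_comp (hf i)))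
  -- dominated convergence for series on `[0, 2π]`
  set bound : ι → ℝ → ℝ := fun i _ ↦ R * (1 / R ^ (k + 1)) * u i with hbound
  have h_bound : ∀ i, ∀ᵐ t : ℝ, t ∈ Ι 0 (2 * π) → ‖F i t‖ ≤ bound i t := by
    intro i
    refine Eventually.of_forall fun t _ ↦ ?_
    rw [hF, hbound]; dsimp only
    rw [norm_smul, norm_smul, hderiv_norm, norm_div, norm_one, norm_pow, hw_sub, ← mul_assoc]
    exact mul_le_mul_of_nonneg_left (hle i (w t) (hw_mem t)) (by positivity)
  have h_lim : ∀ᵐ t : ℝ, t ∈ Ι 0 (2 * π) → HasSum (fun i ↦ F i t) (G t) := by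
    refine Eventually.of_forall fun t _ ↦ ?_
    rw [hF, hG]
    exact ((hsum (w t) (hw_mem t)).const_smul _).const_smul _
  have hDCT := intervalIntegral.hasSum_integral_of_dominated_convergence (μ := volume) (a := 0)
    (b := 2 * π) bound (fun i ↦ (hF_cont i).aestronglyMeasurable) h_bound
    (Eventually.of_forall fun t _ ↦ hu.mul_left _)
    (by rw [hbound]; simp_rw [tsum_mul_left]; exact intervalIntegrable_const) h_lim
  -- identify the integrals with the circle integrals
  have hFint : ∀ i, ∫ t in (0)..2 * π, F i t = ∮ z in C(c, R), (1 / (z - c) ^ (k + 1)) • f i z := by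
    intro i; rfl
  have hGint : ∫ t in (0)..2 * π, G t = ∮ z in C(c, R), (1 / (z - c) ^ (k + 1)) • g z := rfl
  simp_rw [hFint, hGint, hCg] at hDCT
  have hDCT' : HasSum (fun i ↦ (2 * π * I / k.factorial) • iteratedDeriv k (f i) c)
      ((2 * π * I / k.factorial) • iteratedDeriv k g c) := by
    refine hDCT.congr_fun fun i ↦ ?_
    exact (hCf i).symm
  -- divide by `2πi/k!`
  have hne : (2 * π * I / k.factorial : ℂ) ≠ 0 :=
    div_ne_zero two_pi_I_ne_zero (by exact_mod_cast k.factorial_ne_zero)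
  have h := hDCT'.const_smul ((2 * π * I / k.factorial : ℂ)⁻¹)
  simp_rw [smul_smul, inv_mul_cancel₀ hne, one_smul] at h
  exact h

/-- **`(d/dz)^k (z − a)⁻¹ = (−1)^k k! (z − a)^{−(k+1)}`** at every point (with Lean's conventions
`0⁻¹ = 0` this holds even at `z = a`); the basic term of the partial-fraction expansions differentiated
termwise by `hasSum_iteratedDeriv_of_summable_norm`. [folklore] -/
theorem iteratedDeriv_inv_sub_const (a : ℂ) (k : ℕ) (s : ℂ) :
    iteratedDeriv k (fun z : ℂ ↦ (z - a)⁻¹) s = (-1) ^ k * k.factorial * ((s - a) ^ (k + 1))⁻¹ := by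
  have h := iter_deriv_inv_linear_sub k (1 : ℂ) a
  have hfun : (fun z : ℂ ↦ (z - a)⁻¹) = fun x ↦ (1 * x - a)⁻¹ := by simp
  rw [iteratedDeriv_eq_iterate, hfun, h]
  dsimp only
  rw [one_pow, mul_one, one_mul, show (-1 - k : ℤ) = -((k + 1 : ℕ) : ℤ) by push_cast; ring, zpow_neg,
    zpow_natCast]

/-- `(d/dz)^k (z + a)⁻¹ = (−1)^k k! (z + a)^{−(k+1)}`. [folklore] -/
theorem iteratedDeriv_inv_add_const (a : ℂ) (k : ℕ) (s : ℂ) :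
    iteratedDeriv k (fun z : ℂ ↦ (z + a)⁻¹) s = (-1) ^ k * k.factorial * ((s + a) ^ (k + 1))⁻¹ := by
  have := iteratedDeriv_inv_sub_const (-a) k s
  simpa only [sub_neg_eq_add] using this

end Literature.Analysis.Complex

end
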